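import Summits.HodgeConjecture.HodgeConjecture.Theses.LinearSystemTorelli
import Literature.AlgebraicGeometry.HodgeTheory.HodgeRiemannPolarizabilityProofs
import Literature.AlgebraicGeometry.HodgeTheory.SupportedClassesRationalProofs
import Literature.AlgebraicGeometry.HodgeTheory.VanishingCohomologyNontrivialProofs
import Literature.Barriers.HodgeConjecture.GeneralizedHodgeTrivialReasonsSubHodgeProofs
import Literature.AlgebraicGeometry.HodgeTheory.ComplexGysinHodgeType
import Literature.AlgebraicGeometry.HodgeTheory.ComplexGysinRational
import Literature.AlgebraicGeometry.HodgeTheory.ComplexConjugationHolds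
import Literature.AlgebraicGeometry.HodgeTheory.HodgeFiltrationModelsReductionProofs
import Literature.AlgebraicGeometry.Motives.ComplexPointsOrientation
import Literature.NumberTheory.Transcendental.DeRhamTheoremMultiplicative
import Summits.HodgeConjecture.HodgeConjecture.Theorems.LinearSystemTorelliTranscendentalOrSupportedStubCruxOne
import Summits.HodgeConjecture.HodgeConjecture.Theorems.LinearSystemTorelliTranscendentalOrSupportedStubCompletelyReducible
import Summits.HodgeConjecture.HodgeConjecture.Theorems.LinearSystemTorelliTranscendentalOrSupportedStubRankOne
import Summits.HodgeConjecture.HodgeConjecture.Theorems.LinearSystemTorelliTranscendentalOrSupportedStubGysinRangeRational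
import Summits.HodgeConjecture.HodgeConjecture.Theorems.LinearSystemTorelliTranscendentalOrSupportedStubGysinRangeSubHodge
import Summits.HodgeConjecture.HodgeConjecture.Theorems.LinearSystemTorelliTranscendentalOrSupportedStubBootstrapGeneral

/-!
# Crux `TranscendentalOrSupported` (stmt-HodgeConjecture-10853), line `Sketch` — the ASSEMBLY:
# the crux from its Hodge-conjecture part and its GHC-proper residue (isotypic bootstrap, Gysin form)

Helper file for the line skeleton `Cruxes/TranscendentalOrSupported/Lines/Sketch.lean` (v7) of the
crux `TranscendentalOrSupported` of route `LinearSystemTorelli` — GHC(2p, coniveau 1) in Grothendieck's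
corrected sub-Hodge form: for `X` smooth projective of dimension `2p` (`p ≥ 1`), a Hodge model `A`,
rational classes `b j ∈ H²ᵖ(X(ℂ); ℂ)` whose pulled-back span `W` is a sub-Hodge structure
(`W = ⨆_{p'+q'=2p} W ⊓ H^{p',q'}`) with `W ⊓ H^{2p,0} = ⊥`, every `b j` lies in
`N¹ H²ᵖ = supportedClasses X (2p) 1`.

This file LANDS THE LINE'S REDUCTION ITSELF as a sorry-free theorem (registered stub
`stub_transcendentalOrSupported_of_middle_of_phantomGysin`):
`MiddleDivisorSupport → PhantomGysin → TranscendentalOrSupported`, where `MiddleDivisorSupport` is the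
route item stmt-HodgeConjecture-1081 VERBATIM (every rational `(p,p)`-class in `H²ᵖ` of a smooth
projective `2p`-fold is supported on a divisor — the Hodge-conjecture part; Thomas 2005 Thm. 1) and
`PhantomGysin` (hypothesis `hPh`, spelled out = the skeleton's stub `stub_phantomGysin` verbatim) is the
GHC-PROPER RESIDUE in Gysin form: for `p ≥ 2`, every IRREDUCIBLE rationally spanned sub-Hodge structure
`W ⊆ H²ᵖ(X(ℂ); ℂ)` of rank `≥ 2` without `(2p,0)`-part (a "phantom" constituent) meets
`G¹ H²ᵖ(X) := ⨆ im (g_* : Hᵃ(Y(ℂ); ℂ) → H²ᵖ(X(ℂ); ℂ))` — ALL Gysin images from smooth projective `Y` of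
dimension `m < 2p` (Grothendieck's Gysin description of `Filt'¹`, Topology 8 (1969) p. 300) —
non-trivially: the content by which GHC(2p, 1) exceeds the Hodge conjecture (Voisin, J. Open Math.
Probl. 1 (2025) §4.2–4.3, Conj. 4.7 / Prop. 4.8, display (32)); open for every `p ≥ 2`.

Everything else is a THEOREM of the tree landed by this line: `stub_cruxOne_of_middleDivisorSupport`
(p114629: `p = 1` from item 1081), `stub_completelyReducible` (p107582: semisimplicity, fed with the
PROVED `smoothProjective_hodgeStructure_isPolarizable_holds`, p112211), `stub_rankOne` (p107230),
`stub_gysinRangeRational` (p115866), `stub_gysinRangeSubHodge` (p116287), `stub_bootstrapGeneral`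
(p116401). PROOF: glue `G¹ ≤ N¹` UNCONDITIONALLY (Gysin images die off the proper closed image), `G¹`
rationally spanned and sub-Hodge in every model (no Deligne 8.2.8 anywhere); engine
`isotypic_le_supportedClasses_of_ingredients` = strong induction on `dim W` (reducible ⇒ split;
irreducible line ⇒ Hodge line ⇒ HC part; irreducible rank `≥ 2` ⇒ residue ⇒ bootstrap with `S = G¹`
⇒ `W ≤ G¹ ≤ N¹`); `p = 1` separately. Sector `isotypic_le_supportedClasses_of_noPhantom`: on a
phantom-free `2p`-fold the crux at `X` is the divisor support of the rational `(p,p)`-classes of `X`.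
Once the residue is an item with decl `D`, the crux closes by
`stub_transcendentalOrSupported_of_middle_of_phantomGysin MiddleDivisorSupport_holds D_holds`.

References: Grothendieck, Topology 8 (1969) p. 300; Voisin, *Hodge Theory and Complex Algebraic
Geometry I* (2002) §7.3; Voisin, J. Open Math. Probl. 1 (2025) §4.2–4.3; Thomas, JAG 14 (2005) Thm. 1.
-/

-- mandated namespace `Summit.HodgeConjecture.HodgeConjecture.Theorems` trips `dupNamespace` (off tree-wide)
set_option linter.dupNamespace false

noncomputable section

namespace Summit.HodgeConjecture.HodgeConjecture.Theorems

open CategoryTheory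
open Literature.AlgebraicGeometry.HodgeTheory Literature.AlgebraicGeometry.Motives
open Literature.AlgebraicTopology.SingularHomology

variable {n : ℕ} {X : SchemeOver ℂ}

/-! ### Glue: `G¹ ≤ N¹`; `G¹` is a rationally spanned sub-Hodge structure -/
/-- The span of finitely many rational classes is spanned by its rational classes. -/
theorem isotypic_span_isRationalClass_inter_eq {k r : ℕ} {b : Fin r → complexBetti X k}
    (hb : ∀ j, IsRationalClass (b j)) :
    Submodule.span ℂ {x : complexBetti X k | x ∈ Submodule.span ℂ (Set.range b) ∧ IsRationalClass x} =
      Submodule.span ℂ (Set.range b) := by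
  refine le_antisymm (Submodule.span_le.2 fun x hx ↦ hx.1) (Submodule.span_mono ?_)
  rintro _ ⟨j, rfl⟩
  exact ⟨Submodule.subset_span ⟨j, rfl⟩, hb j⟩

/-- **`G¹ ≤ N¹`, unconditionally**: every Gysin image `g_* y` from a smooth projective `Y` of dimension
`m < n = dim X` is supported on the proper closed image `g(Y)`, i.e. lies in `N¹ Hᵏ(X(ℂ); ℂ)` — the
tree's `complexGysin_mem_supportedClasses` (Fulton, Young Tableaux App. B §B.2 Ex. 5, through the PROVED
`gysinMap_restrictCompl_eq_zero_of_field ℂ` and Poincaré duality `OrientationFamily.hasPoincareDuality`)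
with `r = 0`, `s = 1`. [cite: GrothendieckTopology1969, §1 and p. 300] -/
theorem isotypic_iSupGysin_le_supportedClasses (hX : IsSmoothProjective n X) (k : ℕ) :
    (⨆ (μ : OrientationFamily) (m : ℕ) (_ : m < n) (Y : SchemeOver ℂ) (hY : IsSmoothProjective m Y)
        (g : Y ⟶ X) (a : ℕ) (hab : a + 2 * n = k + 2 * m),
        LinearMap.range (complexGysin μ hY hX g hab)) ≤ supportedClasses X k 1 := by
  refine iSup_le fun μ ↦ iSup_le fun m ↦ iSup_le fun hm ↦ iSup_le fun Y ↦ iSup_le fun hY ↦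
    iSup_le fun g ↦ iSup_le fun a ↦ iSup_le fun hab ↦ ?_
  rintro _ ⟨y, rfl⟩
  exact complexGysin_mem_supportedClasses (gysinMap_restrictCompl_eq_zero_of_field ℂ) μ
    μ.hasPoincareDuality hY hX g hab (r := 0) (s := 1) (by omega)
    (by rw [supportedClasses_zero]; exact Submodule.mem_top)

/-- **`G¹` is spanned by its rational classes** (from `stub_gysinRangeRational`, Gysin image by Gysin
image: a supremum of subspaces each spanned by its rational classes is spanned by its rational
classes). [cite: GrothendieckTopology1969, p. 300] -/
theorem isotypic_span_isRationalClass_iSupGysin_eq (hX : IsSmoothProjective n X) (k : ℕ) :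
    Submodule.span ℂ {x : complexBetti X k | x ∈
      (⨆ (μ : OrientationFamily) (m : ℕ) (_ : m < n) (Y : SchemeOver ℂ) (hY : IsSmoothProjective m Y)
        (g : Y ⟶ X) (a : ℕ) (hab : a + 2 * n = k + 2 * m),
        LinearMap.range (complexGysin μ hY hX g hab)) ∧ IsRationalClass x} =
    ⨆ (μ : OrientationFamily) (m : ℕ) (_ : m < n) (Y : SchemeOver ℂ) (hY : IsSmoothProjective m Y)
        (g : Y ⟶ X) (a : ℕ) (hab : a + 2 * n = k + 2 * m),
        LinearMap.range (complexGysin μ hY hX g hab) := by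
  refine le_antisymm (Submodule.span_le.2 fun x hx ↦ hx.1) ?_
  refine iSup_le fun μ ↦ iSup_le fun m ↦ iSup_le fun hm ↦ iSup_le fun Y ↦ iSup_le fun hY ↦
    iSup_le fun g ↦ iSup_le fun a ↦ iSup_le fun hab ↦ ?_
  -- one Gysin image lies in the big supremum ...
  have hle : LinearMap.range (complexGysin μ hY hX g hab) ≤
      ⨆ (μ : OrientationFamily) (m : ℕ) (_ : m < n) (Y : SchemeOver ℂ) (hY : IsSmoothProjective m Y)
        (g : Y ⟶ X) (a : ℕ) (hab : a + 2 * n = k + 2 * m),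
        LinearMap.range (complexGysin μ hY hX g hab) :=
    le_iSup_of_le μ (le_iSup_of_le m (le_iSup_of_le hm (le_iSup_of_le Y (le_iSup_of_le hY
      (le_iSup_of_le g (le_iSup_of_le a (le_iSup_of_le hab le_rfl)))))))
  -- ... and is spanned by its rational classes, which are rational classes of the supremum
  rw [← stub_gysinRangeRational μ hY hX g hab]
  exact Submodule.span_mono fun x hx ↦ ⟨hle hx.1, hx.2⟩

/-- **`G¹` pulled back to any Hodge model `A` is a sub-Hodge structure** (from
`stub_gysinRangeSubHodge`, Gysin image by Gysin image: `map` commutes with suprema and a supremum of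
subspaces `U` with `U ≤ ⨆_{p'+q'=k} U ⊓ H^{p',q'}` again satisfies this inequality; the reverse
inequality is trivial). [cite: GrothendieckTopology1969, p. 300] [cite: VoisinHodgeI2002, §7.3.1 (7.5)] -/
theorem isotypic_map_iSupGysin_eq (hX : IsSmoothProjective n X) (A : HodgeModel n X) (k : ℕ) :
    (⨆ (μ : OrientationFamily) (m : ℕ) (_ : m < n) (Y : SchemeOver ℂ) (hY : IsSmoothProjective m Y)
        (g : Y ⟶ X) (a : ℕ) (hab : a + 2 * n = k + 2 * m),
        LinearMap.range (complexGysin μ hY hX g hab)).map (A.pullback k).hom =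
    ⨆ (p' : ℕ) (q' : ℕ) (_ : p' + q' = k),
      (⨆ (μ : OrientationFamily) (m : ℕ) (_ : m < n) (Y : SchemeOver ℂ) (hY : IsSmoothProjective m Y)
        (g : Y ⟶ X) (a : ℕ) (hab : a + 2 * n = k + 2 * m),
        LinearMap.range (complexGysin μ hY hX g hab)).map (A.pullback k).hom ⊓ A.hodgePQ k p' q' := by
  refine le_antisymm ?_ (iSup_le fun p' ↦ iSup_le fun q' ↦ iSup_le fun _ ↦ inf_le_left)
  rw [Submodule.map_le_iff_le_comap]
  refine iSup_le fun μ ↦ iSup_le fun m ↦ iSup_le fun hm ↦ iSup_le fun Y ↦ iSup_le fun hY ↦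
    iSup_le fun g ↦ iSup_le fun a ↦ iSup_le fun hab ↦ ?_
  rw [← Submodule.map_le_iff_le_comap]
  -- one Gysin image decomposes (`stub_gysinRangeSubHodge`), inside the pieces of the supremum
  refine (stub_gysinRangeSubHodge μ hY hX A g hab (by omega)).le.trans
    (iSup_mono fun p' ↦ iSup_mono fun q' ↦ iSup_mono fun _ ↦
      inf_le_inf_right _ (Submodule.map_mono ?_))
  exact le_iSup_of_le μ (le_iSup_of_le m (le_iSup_of_le hm (le_iSup_of_le Y (le_iSup_of_le hY
    (le_iSup_of_le g (le_iSup_of_le a (le_iSup_of_le hab le_rfl)))))))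

/-- **An irreducible constituent meeting `G¹` lies in `N¹`**: if the span `W` of rational classes
`b j ∈ Hᵏ(X(ℂ); ℂ)` pulls back to an irreducible sub-Hodge structure (its only rationally spanned
sub-Hodge subspaces are `⊥` and `W`) and meets `G¹` non-trivially, then `W ≤ G¹`
(`stub_bootstrapGeneral` with `S = G¹`, a rationally spanned sub-Hodge structure by
`isotypic_span_isRationalClass_iSupGysin_eq` / `isotypic_map_iSupGysin_eq`), hence `W ≤ N¹`
(`isotypic_iSupGysin_le_supportedClasses`). [cite: VoisinHodgeI2002, §7.3.1] -/
theorem isotypic_span_le_supportedClasses_of_inf_iSupGysin_ne_bot (hX : IsSmoothProjective n X)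
    (A : HodgeModel n X) (k r : ℕ) (b : Fin r → complexBetti X k) (hb : ∀ j, IsRationalClass (b j))
    (hsub : (Submodule.span ℂ (Set.range b)).map (A.pullback k).hom =
      ⨆ (p' : ℕ) (q' : ℕ) (_ : p' + q' = k),
        (Submodule.span ℂ (Set.range b)).map (A.pullback k).hom ⊓ A.hodgePQ k p' q')
    (hirr : ∀ V : Submodule ℂ (complexBetti X k), V ≤ Submodule.span ℂ (Set.range b) →
      Submodule.span ℂ {x : complexBetti X k | x ∈ V ∧ IsRationalClass x} = V →
      V.map (A.pullback k).hom =
        ⨆ (p' : ℕ) (q' : ℕ) (_ : p' + q' = k), V.map (A.pullback k).hom ⊓ A.hodgePQ k p' q' →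
      V = ⊥ ∨ V = Submodule.span ℂ (Set.range b))
    (hne : Submodule.span ℂ (Set.range b) ⊓
      (⨆ (μ : OrientationFamily) (m : ℕ) (_ : m < n) (Y : SchemeOver ℂ)
        (hY : IsSmoothProjective m Y) (g : Y ⟶ X) (a : ℕ) (hab : a + 2 * n = k + 2 * m),
        LinearMap.range (complexGysin μ hY hX g hab)) ≠ ⊥) :
    Submodule.span ℂ (Set.range b) ≤ supportedClasses X k 1 := by
  refine le_trans ?_ (isotypic_iSupGysin_le_supportedClasses hX k)
  exact stub_bootstrapGeneral A k _ _ (isotypic_span_isRationalClass_inter_eq hb) hsub hirr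
    (isotypic_span_isRationalClass_iSupGysin_eq hX k) (isotypic_map_iSupGysin_eq hX A k) hne

/-! ### The induction engine -/
/-- **A rationally spanned subspace of `Hᵏ(X(ℂ); ℂ)` is the span of finitely many of its rational
classes** (`Hᵏ(X(ℂ); ℂ)` is finite-dimensional, `finite_complexBetti`; take a linearly independent
spanning subfamily of the rational classes of `V`). -/
theorem isotypic_exists_fin_isRationalClass_span_eq (hX : IsSmoothProjective n X) (k : ℕ)
    (V : Submodule ℂ (complexBetti X k))
    (hV : Submodule.span ℂ {x : complexBetti X k | x ∈ V ∧ IsRationalClass x} = V) :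
    ∃ (r : ℕ) (v : Fin r → complexBetti X k), (∀ i, IsRationalClass (v i)) ∧
      Submodule.span ℂ (Set.range v) = V := by
  haveI : Module.Finite ℂ (complexBetti X k) := finite_complexBetti hX k
  obtain ⟨t, ht, hspan, hli⟩ :=
    exists_linearIndependent ℂ {x : complexBetti X k | x ∈ V ∧ IsRationalClass x}
  have htfin : t.Finite := hli.set_finite_of_isNoetherian
  haveI : Fintype t := htfin.fintype
  refine ⟨Fintype.card t, (↑) ∘ (Fintype.equivFin t).symm,
    fun i ↦ (ht ((Fintype.equivFin t).symm i).2).2, ?_⟩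
  rw [EquivLike.range_comp, Subtype.range_coe, hspan, hV]

/-- **The induction engine, per variety and model** (strong induction on `dim W`): for the `2p`-fold
`X` read in the Hodge model `A`, GIVEN (i) complements of rationally spanned sub-Hodge subspaces
(`hCR`, semisimplicity), (ii) rank-one constituents are Hodge lines (`hR1`), (iii) rational
`(p,p)`-classes are supported on divisors (`hMid`, the Hodge-conjecture part AT `X`) and (iv)
irreducible phantom constituents are supported on divisors (`hPh`, the residue AT `X`, bootstrap
included), every rationally spanned sub-Hodge subspace `W ⊆ H²ᵖ(X(ℂ); ℂ)` without `(2p,0)`-part lies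
in `N¹ H²ᵖ`. Reducible `W` are split by (i) (both summands are smaller and inherit the hypotheses);
irreducible lines are Hodge lines (ii) supported by (iii); irreducible `W` of rank `≥ 2` are supported
by (iv). [cite: VoisinHodgeI2002, §7.3.1] -/
theorem isotypic_le_supportedClasses_of_ingredients {p : ℕ} (hX : IsSmoothProjective (2 * p) X)
    (A : HodgeModel (2 * p) X)
    (hCR : ∀ (V W : Submodule ℂ (complexBetti X (2 * p))),
      Submodule.span ℂ {x : complexBetti X (2 * p) | x ∈ W ∧ IsRationalClass x} = W →
      W.map (A.pullback (2 * p)).hom =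
        ⨆ (p' : ℕ) (q' : ℕ) (_ : p' + q' = 2 * p),
          W.map (A.pullback (2 * p)).hom ⊓ A.hodgePQ (2 * p) p' q' →
      Submodule.span ℂ {x : complexBetti X (2 * p) | x ∈ V ∧ IsRationalClass x} = V →
      V.map (A.pullback (2 * p)).hom =
        ⨆ (p' : ℕ) (q' : ℕ) (_ : p' + q' = 2 * p),
          V.map (A.pullback (2 * p)).hom ⊓ A.hodgePQ (2 * p) p' q' →
      V ≤ W →
      ∃ V' : Submodule ℂ (complexBetti X (2 * p)),
        Submodule.span ℂ {x : complexBetti X (2 * p) | x ∈ V' ∧ IsRationalClass x} = V' ∧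
        V'.map (A.pullback (2 * p)).hom =
          ⨆ (p' : ℕ) (q' : ℕ) (_ : p' + q' = 2 * p),
            V'.map (A.pullback (2 * p)).hom ⊓ A.hodgePQ (2 * p) p' q' ∧
        V ⊓ V' = ⊥ ∧ V ⊔ V' = W)
    (hR1 : ∀ (W : Submodule ℂ (complexBetti X (2 * p))),
      Submodule.span ℂ {x : complexBetti X (2 * p) | x ∈ W ∧ IsRationalClass x} = W →
      W.map (A.pullback (2 * p)).hom =
        ⨆ (p' : ℕ) (q' : ℕ) (_ : p' + q' = 2 * p),
          W.map (A.pullback (2 * p)).hom ⊓ A.hodgePQ (2 * p) p' q' →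
      Module.finrank ℂ W = 1 →
      ∃ w : complexBetti X (2 * p), IsRationalClass w ∧
        A.pullback (2 * p) w ∈ A.hodgePQ (2 * p) p p ∧ Submodule.span ℂ {w} = W)
    (hMid : ∀ w : complexBetti X (2 * p), IsRationalClass w →
      A.pullback (2 * p) w ∈ A.hodgePQ (2 * p) p p → w ∈ supportedClasses X (2 * p) 1)
    (hPh : ∀ (r : ℕ) (b : Fin r → complexBetti X (2 * p)), (∀ j, IsRationalClass (b j)) →
      (Submodule.span ℂ (Set.range b)).map (A.pullback (2 * p)).hom =
        ⨆ (p' : ℕ) (q' : ℕ) (_ : p' + q' = 2 * p),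
          (Submodule.span ℂ (Set.range b)).map (A.pullback (2 * p)).hom ⊓ A.hodgePQ (2 * p) p' q' →
      (Submodule.span ℂ (Set.range b)).map (A.pullback (2 * p)).hom ⊓ A.hodgePQ (2 * p) (2 * p) 0 = ⊥ →
      (∀ V : Submodule ℂ (complexBetti X (2 * p)), V ≤ Submodule.span ℂ (Set.range b) →
        Submodule.span ℂ {x : complexBetti X (2 * p) | x ∈ V ∧ IsRationalClass x} = V →
        V.map (A.pullback (2 * p)).hom =
          ⨆ (p' : ℕ) (q' : ℕ) (_ : p' + q' = 2 * p),
            V.map (A.pullback (2 * p)).hom ⊓ A.hodgePQ (2 * p) p' q' →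
        V = ⊥ ∨ V = Submodule.span ℂ (Set.range b)) →
      2 ≤ Module.finrank ℂ (Submodule.span ℂ (Set.range b)) →
      Submodule.span ℂ (Set.range b) ≤ supportedClasses X (2 * p) 1)
    (W : Submodule ℂ (complexBetti X (2 * p)))
    (hrat : Submodule.span ℂ {x : complexBetti X (2 * p) | x ∈ W ∧ IsRationalClass x} = W)
    (hsub : W.map (A.pullback (2 * p)).hom =
      ⨆ (p' : ℕ) (q' : ℕ) (_ : p' + q' = 2 * p), W.map (A.pullback (2 * p)).hom ⊓ A.hodgePQ (2 * p) p' q')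
    (hbot : W.map (A.pullback (2 * p)).hom ⊓ A.hodgePQ (2 * p) (2 * p) 0 = ⊥) :
    W ≤ supportedClasses X (2 * p) 1 := by
  haveI : Module.Finite ℂ (complexBetti X (2 * p)) := finite_complexBetti hX (2 * p)
  -- strong induction on the dimension of `W`
  suffices key : ∀ (d : ℕ) (W : Submodule ℂ (complexBetti X (2 * p))), Module.finrank ℂ W ≤ d →
      Submodule.span ℂ {x : complexBetti X (2 * p) | x ∈ W ∧ IsRationalClass x} = W →
      W.map (A.pullback (2 * p)).hom =
        ⨆ (p' : ℕ) (q' : ℕ) (_ : p' + q' = 2 * p),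
          W.map (A.pullback (2 * p)).hom ⊓ A.hodgePQ (2 * p) p' q' →
      W.map (A.pullback (2 * p)).hom ⊓ A.hodgePQ (2 * p) (2 * p) 0 = ⊥ →
      W ≤ supportedClasses X (2 * p) 1 from
    key _ W le_rfl hrat hsub hbot
  intro d
  induction d with
  | zero =>
    intro W hd _ _ _
    obtain rfl : W = ⊥ := Submodule.finrank_eq_zero.1 (Nat.le_zero.1 hd)
    exact bot_le
  | succ d ih =>
    intro W hd hrat hsub hbot
    by_cases hirr : ∀ V : Submodule ℂ (complexBetti X (2 * p)), V ≤ W →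
        Submodule.span ℂ {x : complexBetti X (2 * p) | x ∈ V ∧ IsRationalClass x} = V →
        V.map (A.pullback (2 * p)).hom =
          ⨆ (p' : ℕ) (q' : ℕ) (_ : p' + q' = 2 * p),
            V.map (A.pullback (2 * p)).hom ⊓ A.hodgePQ (2 * p) p' q' →
        V = ⊥ ∨ V = W
    · -- `W` is irreducible
      rcases eq_or_ne W ⊥ with rfl | hne
      · exact bot_le
      rcases Nat.lt_or_ge (Module.finrank ℂ W) 2 with hlt | hge
      · -- a line: a Hodge line (ii), supported by (iii)
        have h1 : Module.finrank ℂ W = 1 := by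
          have h0 : Module.finrank ℂ W ≠ 0 := fun h ↦ hne (Submodule.finrank_eq_zero.1 h)
          omega
        obtain ⟨w, hw, hwt, hwW⟩ := hR1 W hrat hsub h1
        rw [← hwW, Submodule.span_singleton_le_iff_mem]
        exact hMid w hw hwt
      · -- a phantom: supported by (iv)
        obtain ⟨r, b, hb, rfl⟩ := isotypic_exists_fin_isRationalClass_span_eq hX (2 * p) W hrat
        exact hPh r b hb hsub hbot hirr hge
    · -- `W` is reducible: split it (i) and use the induction hypothesis
      push Not at hirr
      obtain ⟨V, hVW, hVrat, hVsub, hV0, hVW'⟩ := hirr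
      obtain ⟨V', hV'rat, hV'sub, hdisj, hsup⟩ := hCR V W hrat hsub hVrat hVsub hVW
      have hV'W : V' ≤ W := hsup ▸ le_sup_right
      have hVlt : V < W := lt_of_le_of_ne hVW hVW'
      have hV'lt : V' < W := by
        refine lt_of_le_of_ne hV'W fun h ↦ hV0 ?_
        rw [← inf_eq_left.2 hVW, ← h]
        exact hdisj
      have hdV : Module.finrank ℂ V ≤ d :=
        Nat.lt_succ_iff.1 (lt_of_lt_of_le (Submodule.finrank_lt_finrank_of_lt hVlt) hd)
      have hdV' : Module.finrank ℂ V' ≤ d :=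
        Nat.lt_succ_iff.1 (lt_of_lt_of_le (Submodule.finrank_lt_finrank_of_lt hV'lt) hd)
      have hbotV : V.map (A.pullback (2 * p)).hom ⊓ A.hodgePQ (2 * p) (2 * p) 0 = ⊥ :=
        eq_bot_mono (inf_le_inf_right _ (Submodule.map_mono hVW)) hbot
      have hbotV' : V'.map (A.pullback (2 * p)).hom ⊓ A.hodgePQ (2 * p) (2 * p) 0 = ⊥ :=
        eq_bot_mono (inf_le_inf_right _ (Submodule.map_mono hV'W)) hbot
      rw [← hsup]
      exact sup_le (ih V hdV hVrat hVsub hbotV) (ih V' hdV' hV'rat hV'sub hbotV')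

/-- **Phantom-free varieties: there the crux is the Hodge conjecture** (a sector, independent of the
residue). Let `X` be a smooth projective `2p`-fold read in a Hodge model `A` such that EVERY
irreducible rationally spanned sub-Hodge subspace of `H²ᵖ(X(ℂ); ℂ)` of rank `≥ 2` has a `(2p,0)`-part
(`hNoPh`: no phantom constituents — e.g. `H²ᵖ = Hdg ⊕ T` with `T` irreducible, the very general
member of a big-monodromy family). Then, granted the divisor support of the rational `(p,p)`-classes
OF `X` (`hMid`), every rationally spanned sub-Hodge subspace of `H²ᵖ(X(ℂ); ℂ)` without
`(2p,0)`-part lies in `N¹ H²ᵖ` — the engine fed with the landed `stub_completelyReducible` (and the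
proved polarizability) and `stub_rankOne`. [cite: VoisinHodgeI2002, §7.3.1] -/
theorem isotypic_le_supportedClasses_of_noPhantom {p : ℕ} (hX : IsSmoothProjective (2 * p) X)
    (A : HodgeModel (2 * p) X)
    (hMid : ∀ w : complexBetti X (2 * p), IsRationalClass w →
      A.pullback (2 * p) w ∈ A.hodgePQ (2 * p) p p → w ∈ supportedClasses X (2 * p) 1)
    (hNoPh : ∀ (r : ℕ) (b : Fin r → complexBetti X (2 * p)), (∀ j, IsRationalClass (b j)) →
      (Submodule.span ℂ (Set.range b)).map (A.pullback (2 * p)).hom =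
        ⨆ (p' : ℕ) (q' : ℕ) (_ : p' + q' = 2 * p),
          (Submodule.span ℂ (Set.range b)).map (A.pullback (2 * p)).hom ⊓ A.hodgePQ (2 * p) p' q' →
      (∀ V : Submodule ℂ (complexBetti X (2 * p)), V ≤ Submodule.span ℂ (Set.range b) →
        Submodule.span ℂ {x : complexBetti X (2 * p) | x ∈ V ∧ IsRationalClass x} = V →
        V.map (A.pullback (2 * p)).hom =
          ⨆ (p' : ℕ) (q' : ℕ) (_ : p' + q' = 2 * p),
            V.map (A.pullback (2 * p)).hom ⊓ A.hodgePQ (2 * p) p' q' →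
        V = ⊥ ∨ V = Submodule.span ℂ (Set.range b)) →
      2 ≤ Module.finrank ℂ (Submodule.span ℂ (Set.range b)) →
      (Submodule.span ℂ (Set.range b)).map (A.pullback (2 * p)).hom ⊓ A.hodgePQ (2 * p) (2 * p) 0 ≠ ⊥)
    (W : Submodule ℂ (complexBetti X (2 * p)))
    (hrat : Submodule.span ℂ {x : complexBetti X (2 * p) | x ∈ W ∧ IsRationalClass x} = W)
    (hsub : W.map (A.pullback (2 * p)).hom =
      ⨆ (p' : ℕ) (q' : ℕ) (_ : p' + q' = 2 * p), W.map (A.pullback (2 * p)).hom ⊓ A.hodgePQ (2 * p) p' q')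
    (hbot : W.map (A.pullback (2 * p)).hom ⊓ A.hodgePQ (2 * p) (2 * p) 0 = ⊥) :
    W ≤ supportedClasses X (2 * p) 1 :=
  isotypic_le_supportedClasses_of_ingredients hX A
    (stub_completelyReducible smoothProjective_hodgeStructure_isPolarizable_holds hX A (2 * p))
    (stub_rankOne hX A p) hMid
    (fun r b hb hsub' hbot' hirr hge ↦ absurd hbot' (hNoPh r b hb hsub' hirr hge)) W hrat hsub hbot

/-! ### The crux from its two parts -/
/-- **REGISTERED STUB `stub_transcendentalOrSupported_of_middle_of_phantomGysin` — the line's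
reduction, landed**: the crux `TranscendentalOrSupported` (GHC(2p, coniveau 1) for `H²ᵖ` of smooth
projective `2p`-folds, Grothendieck's sub-Hodge form) follows from
(a) `MiddleDivisorSupport` (route item stmt-HodgeConjecture-1081 verbatim: every rational `(p,p)`-class
in `H²ᵖ` of a smooth projective `2p`-fold, `p ≥ 1`, is supported on a divisor — the Hodge-conjecture
part), and
(b) the GHC-proper residue in Gysin form (`hPh`, = the skeleton's `stub_phantomGysin` verbatim): for
`p ≥ 2`, every irreducible rationally spanned sub-Hodge structure `W ⊆ H²ᵖ(X(ℂ); ℂ)` of rank `≥ 2`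
without `(2p,0)`-part meets `G¹ H²ᵖ(X) = ⨆ im (g_* : Hᵃ(Y(ℂ); ℂ) → H²ᵖ(X(ℂ); ℂ))` (all smooth
projective `Y` of dimension `m < 2p`, all `g`, `μ`, `a`) non-trivially — Voisin's effectivity problem
for coniveau-1 sub-Hodge structures, open for `p ≥ 2`.
Proof: `p = 1` is `stub_cruxOne_of_middleDivisorSupport` (at `p = 1` the span lies in `H^{1,1}`);
for `p ≥ 2`, `b j` lies in the span `W` of the `b`'s, a rationally spanned sub-Hodge structure without
`(2p,0)`-part, and `W ≤ N¹` by the engine `isotypic_le_supportedClasses_of_ingredients` fed with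
`stub_completelyReducible` (+ `smoothProjective_hodgeStructure_isPolarizable_holds`), `stub_rankOne`,
(a) read in `A`, and (b) followed by the bootstrap
(`isotypic_span_le_supportedClasses_of_inf_iSupGysin_ne_bot`).
[cite: GrothendieckTopology1969, p. 300] [cite: VoisinHodgeI2002, §7.3.1–7.3.2] -/
theorem stub_transcendentalOrSupported_of_middle_of_phantomGysin
    (hMid : Summit.HodgeConjecture.HodgeConjecture.Theses.LinearSystemTorelli.MiddleDivisorSupport)
    (hPh : ∀ ⦃p : ℕ⦄ ⦃X : SchemeOver ℂ⦄, 2 ≤ p → ∀ (hX : IsSmoothProjective (2 * p) X)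
      (A : HodgeModel (2 * p) X) (r : ℕ) (b : Fin r → complexBetti X (2 * p)),
      (∀ j, IsRationalClass (b j)) →
      (Submodule.span ℂ (Set.range b)).map (A.pullback (2 * p)).hom =
        ⨆ (p' : ℕ) (q' : ℕ) (_ : p' + q' = 2 * p),
          (Submodule.span ℂ (Set.range b)).map (A.pullback (2 * p)).hom ⊓ A.hodgePQ (2 * p) p' q' →
      (Submodule.span ℂ (Set.range b)).map (A.pullback (2 * p)).hom ⊓ A.hodgePQ (2 * p) (2 * p) 0 = ⊥ →
      (∀ V : Submodule ℂ (complexBetti X (2 * p)), V ≤ Submodule.span ℂ (Set.range b) →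
        Submodule.span ℂ {x : complexBetti X (2 * p) | x ∈ V ∧ IsRationalClass x} = V →
        V.map (A.pullback (2 * p)).hom =
          ⨆ (p' : ℕ) (q' : ℕ) (_ : p' + q' = 2 * p),
            V.map (A.pullback (2 * p)).hom ⊓ A.hodgePQ (2 * p) p' q' →
        V = ⊥ ∨ V = Submodule.span ℂ (Set.range b)) →
      2 ≤ Module.finrank ℂ (Submodule.span ℂ (Set.range b)) →
      Submodule.span ℂ (Set.range b) ⊓
        (⨆ (μ : OrientationFamily) (m : ℕ) (_ : m < 2 * p) (Y : SchemeOver ℂ)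
          (hY : IsSmoothProjective m Y) (g : Y ⟶ X) (a : ℕ) (hab : a + 2 * (2 * p) = 2 * p + 2 * m),
          LinearMap.range (complexGysin μ hY hX g hab)) ≠ ⊥) :
    Summit.HodgeConjecture.HodgeConjecture.Theses.LinearSystemTorelli.TranscendentalOrSupported := by
  intro p X hp hX A r b hb hsub hbot j
  rcases Nat.lt_or_ge p 2 with hlt | h2
  · -- `p = 1`: the calibration from item 1081
    obtain rfl : p = 1 := by omega
    exact stub_cruxOne_of_middleDivisorSupport hMid hX A r b hb hsub hbot j
  · -- `p ≥ 2`: the engine, fed with the landed stubs, (a) at `X` and (b) at `X` + bootstrap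
    refine isotypic_le_supportedClasses_of_ingredients hX A
      (stub_completelyReducible smoothProjective_hodgeStructure_isPolarizable_holds hX A (2 * p))
      (stub_rankOne hX A p) (fun w hw hwt ↦ hMid (by omega) hX w hw ⟨A, hwt⟩)
      (fun r' b' hb' hsub' hbot' hirr' hge' ↦
        isotypic_span_le_supportedClasses_of_inf_iSupGysin_ne_bot hX A (2 * p) r' b' hb' hsub' hirr'
          (hPh h2 hX A r' b' hb' hsub' hbot' hirr' hge'))
      _ (isotypic_span_isRationalClass_inter_eq hb) hsub hbot (Submodule.subset_span ⟨j, rfl⟩)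

end Summit.HodgeConjecture.HodgeConjecture.Theorems

end
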